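import Summits.Ventures.QEC.Census.CertCoverChecks
import Summits.Ventures.QEC.Census.BB.BB288.CoverWitOK2
import Summits.Ventures.QEC.Census.BB.BB288.CoverAuts
import Summits.Ventures.QEC.Census.BB.BB288.CoverReps
import Summits.Ventures.QEC.Census.BB.BB288.CoverFound2A
import Summits.Ventures.QEC.Census.BB.BB288.CoverFound2B
import Summits.Ventures.QEC.Census.BB.BB288.CoverWit2A
import Summits.Ventures.QEC.Census.BB.BB288.CoverWit2B
import Summits.Ventures.QEC.Census.BB.BB288.CoverWit1
import Summits.Ventures.QEC.Census.BB.BB288.CoverL21D00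
import Summits.Ventures.QEC.Census.BB.BB288.CoverL21D01
import Summits.Ventures.QEC.Census.BB.BB288.CoverL21D02
import Summits.Ventures.QEC.Census.BB.BB288.CoverL21D03
import Summits.Ventures.QEC.Census.BB.BB288.CoverL21D04
import Summits.Ventures.QEC.Census.BB.BB288.CoverL21D05
import Summits.Ventures.QEC.Census.BB.BB288.CoverL21D06
import HarnessLib

set_option Elab.async false

/-!
# `[[288,12,18]]` cover certificate — VERDICTS of the witness tables: every FOUND₂ word is carried by a listed translation
shadow to its level-2→1 representative (`wit2_ok`, in CoverWitOK2, re-exported by import); every word generated by a level-2→1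
problem is carried to its level-1→0 representative (`wit1_ok`, here).
(qec-search-9 g3 frozen module, split in two by g4 for the farm's time budget; theorem names unchanged.)
-/

namespace Summit.Ventures.QEC.Census.BB288Cover

open Summit.Ventures.QEC.Census

set_option maxHeartbeats 400000000 in
/-- The level-1 witness table is valid. -/
theorem wit1_ok : witnessOK 144 permqs reps1 wit1 = true := by
  decide +kernel

end Summit.Ventures.QEC.Census.BB288Cover
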